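import Mathlib
import Literature.MathematicalPhysics.QuantumFieldTheory.LatticeGaugeDobrushinPoincare
import HarnessLib

/-!
# Quadratic (Morse) bounds for tilted exponents on a closed matrix group

General-purpose support file (everything PROVED, no named fact, no definition) for Laplace-type
estimates such as `Literature.MathematicalPhysics.QuantumFieldTheory.OneLinkLaplaceConcentration`
(`PinnedOneLinkLaplace.lean`; its own discharge runs through the `PinnedOneLinkLaplace*` files —
the present file is the abstract form, for ANY closed matrix group `S ⊆ U(N)` and ANY `C^{1,1}`
perturbation `W`, kept for reuse): the uniform version of Breitung's Lemma 40 (LNM 1592, Ch. 5,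
p. 55: near a unique non-degenerate maximum the deficit is pinched between two quadratics) for the
family of exponents `Φ(A) = Re tr(Hᴴ A) + t W(A)` restricted to a closed matrix group
`S ⊆ U(N)`, `H ∈ S`, `t` small, `W` a `C^{1,1}` perturbation — WITHOUT charts on `S` beyond the
von Neumann exponential chart at `1` (taken as a hypothesis, see
`Literature.Analysis.Calculus.exists_exp_chart_range`):

* `OneLinkLaplace.deficit_bounds`: at a maximiser `B₀ ∈ S` of `Φ` on `S`,
  `κ ‖A - B₀‖_F² ≤ Φ B₀ - Φ A ≤ K ‖A - B₀‖_F²` for all `A ∈ S`, with `κ, K > 0` depending only on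
  `N`, the chart radius and the `C^{1,1}` constant of `W`.

Mechanism (all norms Frobenius, `frobNorm` of `LatticeGaugeDobrushinPoincare`): on the sphere
`S ⊆ {‖A‖_F² = N}` one has the identity `Re tr(B₀ᴴ (B₀ - A)) = ½ ‖A - B₀‖_F²`, so
`Φ B₀ - Φ A = ½‖A - B₀‖² - λ(A - B₀) - t R` with a linear functional `λ` of norm `≤ 3tL`
(maximality at `H` gives `‖H - B₀‖ ≤ 2tL`) and `|R| ≤ L‖A - B₀‖²`; maximality along the
one-parameter subgroups `exp(τX) B₀ ⊆ S` kills `λ` on the tangent directions `X B₀`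
(`eq_zero_of_forall_mul_le_sq`), and the exponential chart writes `A - B₀ = X B₀ + O(‖A - B₀‖²)`
with tangent `X`, whence `|λ(A - B₀)| ≤ 12 tL ‖A - B₀‖²` near `B₀`; far from `B₀` compactness
(`‖A - B₀‖ ≤ 2√N`) and maximality at `H` suffice.  We also record the elementary Taylor bounds
for words of length four in unitary letters (`word_…`), which give the `C^{1,1}` constants of the
lattice perturbations, and the exponential remainder bounds `‖exp X - 1 - X‖ ≤ ‖X‖²` (`‖X‖ ≤ 1`).

## References

* K. W. Breitung, *Asymptotic Approximations for Probability Integrals*, LNM 1592 (1994), Ch. 5,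
  Lemma 40 (p. 55), Thm. 41 (p. 56), Thm. 44 (p. 62).
-/

noncomputable section

open NormedSpace Filter
open scoped Matrix ComplexConjugate Topology

namespace Literature.MathematicalPhysics.QuantumFieldTheory

namespace OneLinkLaplace

/-! ## Exponential remainder bounds in a Banach algebra -/

section ExpRemainder

variable {𝔸 : Type*} [NormedRing 𝔸] [NormedAlgebra ℝ 𝔸] [CompleteSpace 𝔸]

/-- `‖exp X - 1 - X‖ ≤ e^{‖X‖} - 1 - ‖X‖` (termwise comparison of the exponential series).
[folklore] -/
theorem norm_exp_sub_one_sub_le (X : 𝔸) : ‖exp X - 1 - X‖ ≤ Real.exp ‖X‖ - 1 - ‖X‖ := by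
  set f : ℕ → 𝔸 := fun n => ((n.factorial : ℝ)⁻¹) • X ^ n with hf
  have hfs : HasSum f (exp X) := exp_series_hasSum_exp' (𝕂 := ℝ) X
  have hns : Summable (fun n => ‖f n‖) := norm_expSeries_summable' (𝕂 := ℝ) X
  have h2 : HasSum (fun n => f (n + 2)) (exp X - 1 - X) := by
    have h := (hasSum_nat_add_iff' 2).mpr hfs
    have h0 : ∑ i ∈ Finset.range 2, f i = 1 + X := by
      simp [hf, Finset.sum_range_succ]
    rw [h0, show exp X - (1 + X) = exp X - 1 - X by abel] at h
    exact h
  set g : ℕ → ℝ := fun n => ‖X‖ ^ n / n.factorial with hg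
  have hgs : HasSum g (Real.exp ‖X‖) := by
    rw [Real.exp_eq_exp_ℝ]
    exact expSeries_div_hasSum_exp ‖X‖
  have hg2 : HasSum (fun n => g (n + 2)) (Real.exp ‖X‖ - 1 - ‖X‖) := by
    have h := (hasSum_nat_add_iff' 2).mpr hgs
    have h0 : ∑ i ∈ Finset.range 2, g i = 1 + ‖X‖ := by
      simp [hg, Finset.sum_range_succ]
    rw [h0, show Real.exp ‖X‖ - (1 + ‖X‖) = Real.exp ‖X‖ - 1 - ‖X‖ by ring] at h
    exact h
  have hle : ∀ n, ‖f (n + 2)‖ ≤ g (n + 2) := by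
    intro n
    simp only [hf, hg]
    rw [norm_smul, norm_inv, Real.norm_natCast, div_eq_inv_mul]
    gcongr
    exact norm_pow_le' _ (by omega)
  rw [← h2.tsum_eq, ← hg2.tsum_eq]
  refine (norm_tsum_le_tsum_norm ((hasSum_nat_add_iff' 2).mpr hns.hasSum).summable).trans ?_
  exact Summable.tsum_le_tsum hle ((hasSum_nat_add_iff' 2).mpr hns.hasSum).summable hg2.summable

/-- For `‖X‖ ≤ 1`: `‖exp X - 1 - X‖ ≤ ‖X‖²`. [folklore] -/
theorem norm_exp_sub_one_sub_le_sq {X : 𝔸} (hX : ‖X‖ ≤ 1) : ‖exp X - 1 - X‖ ≤ ‖X‖ ^ 2 := by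
  refine (norm_exp_sub_one_sub_le X).trans ?_
  have h := Real.abs_exp_sub_one_sub_id_le (x := ‖X‖) (by rwa [abs_of_nonneg (norm_nonneg _)])
  exact (le_abs_self _).trans h

end ExpRemainder

/-! ## An elementary lemma: a linear function dominated by a quadratic near `0` vanishes -/

/-- If `a τ ≤ M τ²` for all `|τ| ≤ τ₀` (`τ₀ > 0`), then `a = 0`. [folklore] -/
theorem eq_zero_of_forall_mul_le_sq {a M τ₀ : ℝ} (hτ₀ : 0 < τ₀) (hM : 0 ≤ M)
    (h : ∀ τ : ℝ, |τ| ≤ τ₀ → a * τ ≤ M * τ ^ 2) : a = 0 := by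
  by_contra ha
  -- the test time `τ = ± min τ₀ (|a| / (2 (M + 1)))`
  set σ : ℝ := min τ₀ (|a| / (2 * (M + 1))) with hσ
  have hapos : 0 < |a| := abs_pos.mpr ha
  have hσpos : 0 < σ := lt_min hτ₀ (by positivity)
  have hσle : σ ≤ τ₀ := min_le_left _ _
  have hσle' : σ ≤ |a| / (2 * (M + 1)) := min_le_right _ _
  have hkey : |a| * σ ≤ M * σ ^ 2 := by
    rcases lt_or_gt_of_ne ha with hneg | hpos
    · have h1 := h (-σ) (by rw [abs_neg, abs_of_pos hσpos]; exact hσle)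
      rw [abs_of_neg hneg]
      nlinarith
    · have h1 := h σ (by rw [abs_of_pos hσpos]; exact hσle)
      rw [abs_of_pos hpos]
      exact h1
  have h2 : M * σ ^ 2 ≤ |a| * σ / 2 := by
    have : M * σ ≤ |a| / 2 := by
      calc M * σ ≤ (M + 1) * σ := by nlinarith
        _ ≤ (M + 1) * (|a| / (2 * (M + 1))) := by gcongr
        _ = |a| / 2 := by field_simp
    nlinarith
  nlinarith

/-! ## Frobenius-norm algebra on `M_N(ℂ)` -/

section Frobenius

variable {N : ℕ}

/-- `‖A B‖_F ≤ ‖A‖_F ‖B‖_F` (submultiplicativity, from Mathlib's Frobenius normed ring). [folklore] -/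
theorem frobNorm_mul_le (A B : Matrix (Fin N) (Fin N) ℂ) : frobNorm (A * B) ≤ frobNorm A * frobNorm B := by
  have h := (open scoped Matrix.Norms.Frobenius in Matrix.frobenius_norm_mul A B)
  rw [frobNorm_eq_norm, frobNorm_eq_norm, frobNorm_eq_norm]
  exact h

/-- `Re tr(Aᴴ B) = Re tr(Bᴴ A)`. [folklore] -/
theorem re_trace_conjTranspose_mul_comm (A B : Matrix (Fin N) (Fin N) ℂ) :
    (Aᴴ * B).trace.re = (Bᴴ * A).trace.re := by
  have h : (Aᴴ * B)ᴴ = Bᴴ * A := by rw [Matrix.conjTranspose_mul, Matrix.conjTranspose_conjTranspose]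
  rw [← h, Matrix.trace_conjTranspose, Complex.star_def, Complex.conj_re]

/-- Polarisation: `‖A - B‖_F² = ‖A‖_F² + ‖B‖_F² - 2 Re tr(Bᴴ A)`. [folklore] -/
theorem frobNorm_sub_sq (A B : Matrix (Fin N) (Fin N) ℂ) :
    frobNorm (A - B) ^ 2 = frobNorm A ^ 2 + frobNorm B ^ 2 - 2 * (Bᴴ * A).trace.re := by
  rw [frobNorm_sq_eq_re_trace, frobNorm_sq_eq_re_trace, frobNorm_sq_eq_re_trace,
    Matrix.conjTranspose_sub, Matrix.sub_mul, Matrix.mul_sub, Matrix.mul_sub]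
  simp only [Matrix.trace_sub, Complex.sub_re]
  rw [re_trace_conjTranspose_mul_comm A B]
  ring

/-- **The sphere identity.** For unitary `A, B`: `Re tr(Bᴴ (B - A)) = ½ ‖A - B‖_F²`. [folklore] -/
theorem re_trace_conjTranspose_mul_sub_of_mem_unitaryGroup {A B : Matrix (Fin N) (Fin N) ℂ}
    (hA : A ∈ Matrix.unitaryGroup (Fin N) ℂ) (hB : B ∈ Matrix.unitaryGroup (Fin N) ℂ) :
    (Bᴴ * (B - A)).trace.re = frobNorm (A - B) ^ 2 / 2 := by
  rw [frobNorm_sub_sq, frobNorm_sq_of_mem_unitaryGroup hA, frobNorm_sq_of_mem_unitaryGroup hB,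
    Matrix.mul_sub, Matrix.trace_sub, Complex.sub_re, ← frobNorm_sq_eq_re_trace,
    frobNorm_sq_of_mem_unitaryGroup hB]
  ring

/-- Cauchy–Schwarz: `|Re tr(Aᴴ B)| ≤ ‖A‖_F ‖B‖_F`. [folklore] -/
theorem abs_re_trace_conjTranspose_mul_le (A B : Matrix (Fin N) (Fin N) ℂ) :
    |(Aᴴ * B).trace.re| ≤ frobNorm A * frobNorm B := by
  have h := abs_re_trace_mul_le Aᴴ B
  rwa [frobNorm_conjTranspose] at h

/-- `‖1‖_F = √N`. [folklore] -/
theorem frobNorm_one : frobNorm (1 : Matrix (Fin N) (Fin N) ℂ) = Real.sqrt N := by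
  have h := frobNorm_sq_of_mem_unitaryGroup (Submonoid.one_mem (Matrix.unitaryGroup (Fin N) ℂ))
  rw [Fintype.card_fin] at h
  rw [← h, Real.sqrt_sq (frobNorm_nonneg _)]

/-- `|Re tr X| ≤ √N ‖X‖_F`. [folklore] -/
theorem abs_re_trace_le (X : Matrix (Fin N) (Fin N) ℂ) : |X.trace.re| ≤ Real.sqrt N * frobNorm X := by
  have h := abs_re_trace_conjTranspose_mul_le (1 : Matrix (Fin N) (Fin N) ℂ) X
  rwa [Matrix.conjTranspose_one, Matrix.one_mul, frobNorm_one] at h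

/-- `‖U‖_F = √N` for unitary `U`. [folklore] -/
theorem frobNorm_of_mem_unitaryGroup {U : Matrix (Fin N) (Fin N) ℂ} (hU : U ∈ Matrix.unitaryGroup (Fin N) ℂ) :
    frobNorm U = Real.sqrt N := by
  have h := frobNorm_sq_of_mem_unitaryGroup hU
  rw [Fintype.card_fin] at h
  rw [← h, Real.sqrt_sq (frobNorm_nonneg _)]

/-- For `‖X‖_F ≤ 1`: `‖exp X - 1 - X‖_F ≤ ‖X‖_F²` (Frobenius form of
`norm_exp_sub_one_sub_le_sq`). [folklore] -/
theorem frobNorm_exp_sub_one_sub_le_sq {X : Matrix (Fin N) (Fin N) ℂ} (hX : frobNorm X ≤ 1) :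
    frobNorm (exp X - 1 - X) ≤ frobNorm X ^ 2 := by
  rw [frobNorm_eq_norm] at hX
  rw [frobNorm_eq_norm, frobNorm_eq_norm]
  have h := (open scoped Matrix.Norms.Frobenius in
    norm_exp_sub_one_sub_le_sq (𝔸 := Matrix (Fin N) (Fin N) ℂ) hX)
  exact h

/-- `‖τ • X‖_F = |τ| ‖X‖_F` for real `τ`. [folklore] -/
theorem frobNorm_real_smul (τ : ℝ) (X : Matrix (Fin N) (Fin N) ℂ) :
    frobNorm (τ • X) = |τ| * frobNorm X := by
  unfold frobNorm
  have h : ∑ i, ∑ j, ‖(τ • X) i j‖ ^ 2 = τ ^ 2 * ∑ i, ∑ j, ‖X i j‖ ^ 2 := by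
    rw [Finset.mul_sum]
    refine Finset.sum_congr rfl fun i _ => ?_
    rw [Finset.mul_sum]
    refine Finset.sum_congr rfl fun j _ => ?_
    rw [Matrix.smul_apply, norm_smul, Real.norm_eq_abs, mul_pow, sq_abs]
  rw [h, Real.sqrt_mul (sq_nonneg τ), Real.sqrt_sq_eq_abs]

/-- `‖U X V‖_F = ‖X‖_F` for unitary `U, V`. [folklore] -/
theorem frobNorm_unitary_mul_mul_unitary {U V : Matrix (Fin N) (Fin N) ℂ}
    (hU : U ∈ Matrix.unitaryGroup (Fin N) ℂ) (hV : V ∈ Matrix.unitaryGroup (Fin N) ℂ)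
    (X : Matrix (Fin N) (Fin N) ℂ) : frobNorm (U * X * V) = frobNorm X := by
  rw [frobNorm_mul_unitary _ hV, frobNorm_unitary_mul hU]

/-- `frobNorm X = 0 → X = 0`. [folklore] -/
theorem eq_zero_of_frobNorm_eq_zero {X : Matrix (Fin N) (Fin N) ℂ} (h : frobNorm X = 0) : X = 0 := by
  rw [frobNorm_eq_norm] at h
  have h2 := (open scoped Matrix.Norms.Frobenius in
    (norm_eq_zero (E := Matrix (Fin N) (Fin N) ℂ) (a := X)).mp h)
  exact h2

/-- The conjugate transpose of a unitary matrix is unitary. [folklore] -/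
theorem conjTranspose_mem_unitaryGroup {U : Matrix (Fin N) (Fin N) ℂ}
    (hU : U ∈ Matrix.unitaryGroup (Fin N) ℂ) : Uᴴ ∈ Matrix.unitaryGroup (Fin N) ℂ := by
  rw [← Matrix.star_eq_conjTranspose]
  exact Unitary.star_mem hU

/-- `U Uᴴ = 1` for unitary `U`. [folklore] -/
theorem mul_conjTranspose_of_mem_unitaryGroup {U : Matrix (Fin N) (Fin N) ℂ}
    (hU : U ∈ Matrix.unitaryGroup (Fin N) ℂ) : U * Uᴴ = 1 := by
  rw [← Matrix.star_eq_conjTranspose]; exact Matrix.mem_unitaryGroup_iff.1 hU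

/-- `Uᴴ U = 1` for unitary `U`. [folklore] -/
theorem conjTranspose_mul_of_mem_unitaryGroup {U : Matrix (Fin N) (Fin N) ℂ}
    (hU : U ∈ Matrix.unitaryGroup (Fin N) ℂ) : Uᴴ * U = 1 := by
  rw [← Matrix.star_eq_conjTranspose]; exact Matrix.mem_unitaryGroup_iff'.1 hU

end Frobenius

/-! ## Quadratic (Morse) bounds of the deficit at a maximiser -/

section Morse

variable {N : ℕ}

/-- **Uniform Morse bounds for tilted exponents on a closed matrix group** (the uniform form of
Breitung's Lemma 40).  Let `S ⊆ U(N)` be closed under products and adjoints and admit the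
exponential chart at `1` with radius `r₀` (every `u ∈ S` with `‖u - 1‖_F < r₀` is `exp X` with
`exp(ℝX) ⊆ S`, `‖X‖_F ≤ 2‖u - 1‖_F`).  Let `Φ(A) = Re tr(Hᴴ A) + t W(A)` with `H ∈ S`, `t ≥ 0`,
`W` Lipschitz with constant `L` on `S` and with a linear first-order part `ℓ_B` at every `B ∈ S`
(`|ℓ_B x| ≤ L‖x‖_F`, `|W A - W B - ℓ_B(A - B)| ≤ L ‖A - B‖_F²`), and `t L ≤ 1/52`,
`t L ≤ min(r₀, 1/2)/8`.  If `B₀ ∈ S` maximises `Φ` on `S`, then for every `A ∈ S`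
`κ ‖A - B₀‖_F² ≤ Φ B₀ - Φ A ≤ K ‖A - B₀‖_F²` with `κ = min(1/4, min(r₀,1/2)²/(16(4N+1)))`,
`K = max(3/4, (√N + 1)/min(r₀,1/2))`. [cite: Breitung1994, Ch. 5 Lemma 40] -/
theorem deficit_bounds {S : Set (Matrix (Fin N) (Fin N) ℂ)}
    (hSU : S ⊆ (Matrix.unitaryGroup (Fin N) ℂ : Set (Matrix (Fin N) (Fin N) ℂ)))
    (hSmul : ∀ a ∈ S, ∀ b ∈ S, a * b ∈ S) (hSstar : ∀ a ∈ S, aᴴ ∈ S)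
    {r₀ : ℝ} (hr₀ : 0 < r₀)
    (hchart : ∀ u ∈ S, frobNorm (u - 1) < r₀ → ∃ X : Matrix (Fin N) (Fin N) ℂ,
      (∀ τ : ℝ, exp (τ • X) ∈ S) ∧ exp X = u ∧ frobNorm X ≤ 2 * frobNorm (u - 1))
    {W : Matrix (Fin N) (Fin N) ℂ → ℝ} {ℓ : Matrix (Fin N) (Fin N) ℂ → Matrix (Fin N) (Fin N) ℂ → ℝ}
    {L : ℝ} (hL : 0 < L)
    (hW1 : ∀ A ∈ S, ∀ B ∈ S, |W A - W B| ≤ L * frobNorm (A - B))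
    (hℓadd : ∀ B x y, ℓ B (x + y) = ℓ B x + ℓ B y)
    (hℓsmul : ∀ B (c : ℝ) x, ℓ B (c • x) = c * ℓ B x)
    (hℓle : ∀ B ∈ S, ∀ x, |ℓ B x| ≤ L * frobNorm x)
    (hW2 : ∀ A ∈ S, ∀ B ∈ S, |W A - W B - ℓ B (A - B)| ≤ L * frobNorm (A - B) ^ 2)
    {H : Matrix (Fin N) (Fin N) ℂ} (hH : H ∈ S) {t : ℝ} (ht0 : 0 ≤ t) (ht1 : t * L ≤ 1 / 52)
    (ht2 : t * L ≤ min r₀ (1 / 2) / 8)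
    {B₀ : Matrix (Fin N) (Fin N) ℂ} (hB₀ : B₀ ∈ S)
    (hmax : ∀ A ∈ S, (Hᴴ * A).trace.re + t * W A ≤ (Hᴴ * B₀).trace.re + t * W B₀)
    {A : Matrix (Fin N) (Fin N) ℂ} (hA : A ∈ S) :
    min (1 / 4 : ℝ) ((min r₀ (1 / 2)) ^ 2 / (16 * (4 * N + 1))) * frobNorm (A - B₀) ^ 2
        ≤ ((Hᴴ * B₀).trace.re + t * W B₀) - ((Hᴴ * A).trace.re + t * W A) ∧
      ((Hᴴ * B₀).trace.re + t * W B₀) - ((Hᴴ * A).trace.re + t * W A)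
        ≤ max (3 / 4 : ℝ) ((Real.sqrt N + 1) / min r₀ (1 / 2)) * frobNorm (A - B₀) ^ 2 := by
  -- notation and basic facts
  set r₁ : ℝ := min r₀ (1 / 2) with hr₁
  have hr₁pos : 0 < r₁ := lt_min hr₀ one_half_pos
  have hr₁r₀ : r₁ ≤ r₀ := min_le_left _ _
  have hr₁half : r₁ ≤ 1 / 2 := min_le_right _ _
  have htL0 : 0 ≤ t * L := mul_nonneg ht0 hL.le
  have hAU : A ∈ Matrix.unitaryGroup (Fin N) ℂ := hSU hA
  have hB₀U : B₀ ∈ Matrix.unitaryGroup (Fin N) ℂ := hSU hB₀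
  have hHU : H ∈ Matrix.unitaryGroup (Fin N) ℂ := hSU hH
  have hHnorm : frobNorm H = Real.sqrt N := frobNorm_of_mem_unitaryGroup hHU
  set Φ : Matrix (Fin N) (Fin N) ℂ → ℝ := fun A => (Hᴴ * A).trace.re + t * W A with hΦ
  -- the linear functional `λ` and its bound
  set lam : Matrix (Fin N) (Fin N) ℂ → ℝ := fun x => ((H - B₀)ᴴ * x).trace.re + t * ℓ B₀ x with hlam
  -- Step 1: `‖B₀ - H‖ ≤ 2 t L`
  have hHB : frobNorm (B₀ - H) ≤ 2 * (t * L) := by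
    have h1 := hmax H hH
    have hsph := re_trace_conjTranspose_mul_sub_of_mem_unitaryGroup hB₀U hHU
    -- `Re tr(Hᴴ (H - B₀)) = ½ ‖B₀ - H‖²`
    have h2 : frobNorm (B₀ - H) ^ 2 / 2 ≤ t * L * frobNorm (B₀ - H) := by
      have h3 : (Hᴴ * (H - B₀)).trace.re ≤ t * (W B₀ - W H) := by
        rw [Matrix.mul_sub, Matrix.trace_sub, Complex.sub_re]; linarith
      have h4 : t * (W B₀ - W H) ≤ t * (L * frobNorm (B₀ - H)) :=
        mul_le_mul_of_nonneg_left ((le_abs_self _).trans (hW1 B₀ hB₀ H hH)) ht0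
      rw [hsph] at h3; linarith
    have h0 : 0 ≤ frobNorm (B₀ - H) := frobNorm_nonneg _
    nlinarith
  have hlam_le : ∀ x, |lam x| ≤ 3 * (t * L) * frobNorm x := by
    intro x
    have h1 := abs_re_trace_conjTranspose_mul_le (H - B₀) x
    have h2 := hℓle B₀ hB₀ x
    have h3 : frobNorm (H - B₀) ≤ 2 * (t * L) := by rwa [frobNorm_sub_comm] at hHB
    calc |lam x| ≤ |((H - B₀)ᴴ * x).trace.re| + |t * ℓ B₀ x| := abs_add_le _ _
      _ ≤ frobNorm (H - B₀) * frobNorm x + t * (L * frobNorm x) := by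
          rw [abs_mul, abs_of_nonneg ht0]
          exact add_le_add h1 (mul_le_mul_of_nonneg_left h2 ht0)
      _ ≤ 2 * (t * L) * frobNorm x + t * (L * frobNorm x) := by
          gcongr; exact frobNorm_nonneg x
      _ = 3 * (t * L) * frobNorm x := by ring
  have hlam_add : ∀ x y, lam (x + y) = lam x + lam y := by
    intro x y
    simp only [hlam, Matrix.mul_add, Matrix.trace_add, Complex.add_re, hℓadd]
    ring
  have hlam_smul : ∀ (c : ℝ) x, lam (c • x) = c * lam x := by
    intro c x
    simp only [hlam, Matrix.mul_smul, Matrix.trace_smul, Complex.real_smul, Complex.mul_re,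
      Complex.ofReal_re, Complex.ofReal_im, zero_mul, sub_zero, hℓsmul]
    ring
  -- Step 2: the key identity `Φ B₀ - Φ A' = ½δ² - λ Δ - t R`, `|R| ≤ L δ²`, for `A' ∈ S`
  have hKI : ∀ A' ∈ S, |Φ B₀ - Φ A' - (frobNorm (A' - B₀) ^ 2 / 2 - lam (A' - B₀))| ≤
      t * L * frobNorm (A' - B₀) ^ 2 := by
    intro A' hA'
    have hsph := re_trace_conjTranspose_mul_sub_of_mem_unitaryGroup (hSU hA') hB₀U
    have hR := hW2 A' hA' B₀ hB₀
    have hid : Φ B₀ - Φ A' - (frobNorm (A' - B₀) ^ 2 / 2 - lam (A' - B₀)) =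
        -(t * (W A' - W B₀ - ℓ B₀ (A' - B₀))) := by
      simp only [hΦ, hlam]
      rw [← hsph]
      simp only [Matrix.conjTranspose_sub, Matrix.sub_mul, Matrix.mul_sub, Matrix.trace_sub,
        Complex.sub_re]
      ring
    rw [hid, abs_neg, abs_mul, abs_of_nonneg ht0, mul_assoc]
    exact mul_le_mul_of_nonneg_left hR ht0
  -- Step 3: first-order optimality along the one-parameter subgroups through `B₀`
  have hopt : ∀ X : Matrix (Fin N) (Fin N) ℂ, (∀ τ : ℝ, exp (τ • X) ∈ S) → lam (X * B₀) = 0 := by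
    intro X hX
    by_cases hX0 : frobNorm X = 0
    · rw [eq_zero_of_frobNorm_eq_zero hX0, Matrix.zero_mul]
      have := hlam_smul 0 0
      rwa [zero_smul, zero_mul] at this
    have hfX : 0 < frobNorm X := lt_of_le_of_ne (frobNorm_nonneg X) (Ne.symm hX0)
    refine eq_zero_of_forall_mul_le_sq (τ₀ := (frobNorm X)⁻¹) (M := 3 * frobNorm X ^ 2)
      (by positivity) (by positivity) fun τ hτ => ?_
    have hτX : |τ| * frobNorm X ≤ 1 := by
      rwa [inv_eq_one_div, le_div_iff₀ hfX] at hτ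
    have hAτ : exp (τ • X) * B₀ ∈ S := hSmul _ (hX τ) _ hB₀
    have hdefτ := hmax _ hAτ
    have hKIτ := hKI _ hAτ
    set E : Matrix (Fin N) (Fin N) ℂ := exp (τ • X) - 1 - τ • X with hE
    have hΔ : exp (τ • X) * B₀ - B₀ = τ • (X * B₀) + E * B₀ := by
      rw [hE, ← smul_mul_assoc]; noncomm_ring
    have hEn : frobNorm E ≤ (|τ| * frobNorm X) ^ 2 := by
      have h := frobNorm_exp_sub_one_sub_le_sq (X := τ • X) (by rwa [frobNorm_real_smul])
      rwa [frobNorm_real_smul] at h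
    have hEB : frobNorm (E * B₀) = frobNorm E := frobNorm_mul_unitary _ hB₀U
    have hδτ : frobNorm (exp (τ • X) * B₀ - B₀) ≤ 2 * (|τ| * frobNorm X) := by
      rw [hΔ]
      calc frobNorm (τ • (X * B₀) + E * B₀) ≤ frobNorm (τ • (X * B₀)) + frobNorm (E * B₀) :=
            frobNorm_add_le _ _
        _ = |τ| * frobNorm X + frobNorm E := by
            rw [frobNorm_real_smul, frobNorm_mul_unitary _ hB₀U, hEB]
        _ ≤ |τ| * frobNorm X + (|τ| * frobNorm X) ^ 2 := by linarith [hEn]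
        _ ≤ 2 * (|τ| * frobNorm X) := by
            nlinarith [hτX, abs_nonneg τ, frobNorm_nonneg X,
              mul_nonneg (abs_nonneg τ) (frobNorm_nonneg X)]
    have hlamΔ : lam (exp (τ • X) * B₀ - B₀) = τ * lam (X * B₀) + lam (E * B₀) := by
      rw [hΔ, hlam_add, hlam_smul]
    have hlamE : |lam (E * B₀)| ≤ 3 * (t * L) * (|τ| * frobNorm X) ^ 2 := by
      calc |lam (E * B₀)| ≤ 3 * (t * L) * frobNorm (E * B₀) := hlam_le _
        _ ≤ 3 * (t * L) * (|τ| * frobNorm X) ^ 2 := by rw [hEB]; gcongr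
    have hmain : τ * lam (X * B₀) ≤ (1 / 2 + t * L) * (2 * (|τ| * frobNorm X)) ^ 2 +
        3 * (t * L) * (|τ| * frobNorm X) ^ 2 := by
      have h1 : 0 ≤ Φ B₀ - Φ (exp (τ • X) * B₀) := by
        have := hdefτ; simp only [hΦ] at this ⊢; linarith
      have h2 := abs_le.mp hKIτ
      rw [hlamΔ] at h2
      have h3 := abs_le.mp hlamE
      have hδ2 : frobNorm (exp (τ • X) * B₀ - B₀) ^ 2 ≤ (2 * (|τ| * frobNorm X)) ^ 2 :=
        pow_le_pow_left₀ (frobNorm_nonneg _) hδτ 2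
      nlinarith [h2.2, h3.1, hδ2, htL0, sq_nonneg (frobNorm (exp (τ • X) * B₀ - B₀))]
    have hu : (|τ| * frobNorm X) ^ 2 = τ ^ 2 * frobNorm X ^ 2 := by rw [mul_pow, sq_abs]
    rw [hu] at hmain
    calc lam (X * B₀) * τ = τ * lam (X * B₀) := mul_comm _ _
      _ ≤ (1 / 2 + t * L) * (2 * (|τ| * frobNorm X)) ^ 2 + 3 * (t * L) * (τ ^ 2 * frobNorm X ^ 2) :=
          hmain
      _ = (2 + 7 * (t * L)) * (τ ^ 2 * frobNorm X ^ 2) := by rw [mul_pow, mul_pow, sq_abs]; ring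
      _ ≤ 3 * (τ ^ 2 * frobNorm X ^ 2) := by
          apply mul_le_mul_of_nonneg_right _ (by positivity)
          linarith [ht1]
      _ = 3 * frobNorm X ^ 2 * τ ^ 2 := by ring
  -- Steps 4–5: near and far regions (`δ = ‖A - B₀‖_F`)
  have hδ0 : 0 ≤ frobNorm (A - B₀) := frobNorm_nonneg _
  have hdefA := hKI A hA
  show min (1 / 4 : ℝ) (r₁ ^ 2 / (16 * (4 * N + 1))) * frobNorm (A - B₀) ^ 2 ≤ Φ B₀ - Φ A ∧
    Φ B₀ - Φ A ≤ max (3 / 4 : ℝ) ((Real.sqrt N + 1) / r₁) * frobNorm (A - B₀) ^ 2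
  by_cases hnear : frobNorm (A - B₀) < r₁
  · -- near region: the exponential chart at `u = A B₀ᴴ`
    have hu : A * B₀ᴴ ∈ S := hSmul _ hA _ (hSstar _ hB₀)
    have hu1 : frobNorm (A * B₀ᴴ - 1) = frobNorm (A - B₀) := by
      have : A * B₀ᴴ - 1 = (A - B₀) * B₀ᴴ := by
        rw [Matrix.sub_mul, mul_conjTranspose_of_mem_unitaryGroup hB₀U]
      rw [this, frobNorm_mul_unitary _ (conjTranspose_mem_unitaryGroup hB₀U)]
    obtain ⟨X, hXS, hXu, hXle⟩ := hchart _ hu (by rw [hu1]; exact lt_of_lt_of_le hnear hr₁r₀)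
    rw [hu1] at hXle
    have hX1 : frobNorm X ≤ 1 := by linarith [hr₁half]
    set E : Matrix (Fin N) (Fin N) ℂ := exp X - 1 - X with hE
    have hΔ : A - B₀ = X * B₀ + E * B₀ := by
      have h1 : A = exp X * B₀ := by
        rw [hXu, Matrix.mul_assoc, conjTranspose_mul_of_mem_unitaryGroup hB₀U, Matrix.mul_one]
      rw [h1, hE]; noncomm_ring
    have hEn : frobNorm (E * B₀) ≤ 4 * frobNorm (A - B₀) ^ 2 := by
      rw [frobNorm_mul_unitary _ hB₀U]
      calc frobNorm E ≤ frobNorm X ^ 2 := frobNorm_exp_sub_one_sub_le_sq hX1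
        _ ≤ (2 * frobNorm (A - B₀)) ^ 2 := pow_le_pow_left₀ (frobNorm_nonneg _) hXle 2
        _ = 4 * frobNorm (A - B₀) ^ 2 := by ring
    have hlamA : |lam (A - B₀)| ≤ 12 * (t * L) * frobNorm (A - B₀) ^ 2 := by
      have hlamEq : lam (A - B₀) = lam (E * B₀) := by
        rw [hΔ, hlam_add, hopt X hXS, zero_add]
      rw [hlamEq]
      calc |lam (E * B₀)| ≤ 3 * (t * L) * frobNorm (E * B₀) := hlam_le _
        _ ≤ 3 * (t * L) * (4 * frobNorm (A - B₀) ^ 2) := by gcongr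
        _ = 12 * (t * L) * frobNorm (A - B₀) ^ 2 := by ring
    have h1 := abs_le.mp hdefA
    have h2 := abs_le.mp hlamA
    have h13 : 13 * (t * L) * frobNorm (A - B₀) ^ 2 ≤ (1 / 4) * frobNorm (A - B₀) ^ 2 :=
      mul_le_mul_of_nonneg_right (by linarith [ht1]) (sq_nonneg _)
    constructor
    · calc min (1 / 4 : ℝ) (r₁ ^ 2 / (16 * (4 * N + 1))) * frobNorm (A - B₀) ^ 2
          ≤ (1 / 4) * frobNorm (A - B₀) ^ 2 :=
            mul_le_mul_of_nonneg_right (min_le_left _ _) (sq_nonneg _)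
        _ ≤ Φ B₀ - Φ A := by linarith [h1.1, h2.2, h13]
    · calc Φ B₀ - Φ A ≤ (3 / 4) * frobNorm (A - B₀) ^ 2 := by linarith [h1.2, h2.1, h13]
        _ ≤ max (3 / 4 : ℝ) ((Real.sqrt N + 1) / r₁) * frobNorm (A - B₀) ^ 2 :=
            mul_le_mul_of_nonneg_right (le_max_left _ _) (sq_nonneg _)
  · -- far region
    push Not at hnear
    have hδpos : 0 < frobNorm (A - B₀) := lt_of_lt_of_le hr₁pos hnear
    have hδ_le : frobNorm (A - B₀) ≤ 2 * Real.sqrt N := by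
      have h := frobNorm_sub_le_of_mem_unitaryGroup hAU hB₀U
      rwa [Fintype.card_fin] at h
    have hδ2 : frobNorm (A - B₀) ^ 2 ≤ 4 * N + 1 := by
      have hsN : Real.sqrt N ^ 2 = N := Real.sq_sqrt (Nat.cast_nonneg N)
      have h4 : frobNorm (A - B₀) ^ 2 ≤ (2 * Real.sqrt N) ^ 2 := pow_le_pow_left₀ hδ0 hδ_le 2
      rw [mul_pow, hsN] at h4
      linarith
    constructor
    · -- lower bound through the unperturbed centre `H`
      have hΦH : Φ H ≤ Φ B₀ := hmax H hH
      have hy0 : 0 ≤ frobNorm (A - H) := frobNorm_nonneg _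
      have hylow : r₁ / 2 ≤ frobNorm (A - H) := by
        have htri : frobNorm (A - B₀) ≤ frobNorm (A - H) + frobNorm (H - B₀) := frobNorm_sub_le A H B₀
        have hHB' : frobNorm (H - B₀) ≤ 2 * (t * L) := by rwa [frobNorm_sub_comm] at hHB
        linarith [ht2]
      have hHA : frobNorm (A - H) ^ 2 / 2 - t * L * frobNorm (A - H) ≤ Φ H - Φ A := by
        have hsph := re_trace_conjTranspose_mul_sub_of_mem_unitaryGroup hAU hHU
        have hw : -(t * L * frobNorm (A - H)) ≤ t * (W H - W A) := by
          have h' := (abs_le.mp (hW1 H hH A hA)).1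
          rw [frobNorm_sub_comm] at h'
          have h'' := mul_le_mul_of_nonneg_left h' ht0
          linarith
        have hid : Φ H - Φ A = (Hᴴ * (H - A)).trace.re + t * (W H - W A) := by
          simp only [hΦ, Matrix.mul_sub, Matrix.trace_sub, Complex.sub_re]; ring
        rw [hid, hsph]; linarith
      have hquad : r₁ ^ 2 / 16 ≤ frobNorm (A - H) ^ 2 / 2 - t * L * frobNorm (A - H) := by
        have h1 : r₁ / 8 ≤ frobNorm (A - H) / 2 - t * L := by linarith [ht2]
        have h2 : (r₁ / 2) * (r₁ / 8) ≤ frobNorm (A - H) * (frobNorm (A - H) / 2 - t * L) :=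
          mul_le_mul hylow h1 (by positivity) hy0
        linarith [h2]
      calc min (1 / 4 : ℝ) (r₁ ^ 2 / (16 * (4 * N + 1))) * frobNorm (A - B₀) ^ 2
          ≤ r₁ ^ 2 / (16 * (4 * N + 1)) * frobNorm (A - B₀) ^ 2 :=
            mul_le_mul_of_nonneg_right (min_le_right _ _) (sq_nonneg _)
        _ ≤ r₁ ^ 2 / (16 * (4 * N + 1)) * (4 * N + 1) := by gcongr
        _ = r₁ ^ 2 / 16 := by field_simp
        _ ≤ Φ B₀ - Φ A := by linarith [hquad, hHA, hΦH]
    · -- upper bound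
      have hup : Φ B₀ - Φ A ≤ (Real.sqrt N + 1) * frobNorm (A - B₀) := by
        have hid : Φ B₀ - Φ A = (Hᴴ * (B₀ - A)).trace.re + t * (W B₀ - W A) := by
          simp only [hΦ, Matrix.mul_sub, Matrix.trace_sub, Complex.sub_re]; ring
        have h1 : (Hᴴ * (B₀ - A)).trace.re ≤ Real.sqrt N * frobNorm (A - B₀) := by
          have h := (abs_le.mp (abs_re_trace_conjTranspose_mul_le H (B₀ - A))).2
          rwa [hHnorm, frobNorm_sub_comm] at h
        have h2 : t * (W B₀ - W A) ≤ frobNorm (A - B₀) := by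
          have h3 := (abs_le.mp (hW1 B₀ hB₀ A hA)).2
          rw [frobNorm_sub_comm] at h3
          calc t * (W B₀ - W A) ≤ t * (L * frobNorm (A - B₀)) := mul_le_mul_of_nonneg_left h3 ht0
            _ = (t * L) * frobNorm (A - B₀) := by ring
            _ ≤ 1 * frobNorm (A - B₀) := by gcongr; linarith [ht1]
            _ = frobNorm (A - B₀) := one_mul _
        rw [hid]; linarith
      calc Φ B₀ - Φ A ≤ (Real.sqrt N + 1) * frobNorm (A - B₀) := hup
        _ = (Real.sqrt N + 1) / frobNorm (A - B₀) * frobNorm (A - B₀) ^ 2 := by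
            field_simp
        _ ≤ (Real.sqrt N + 1) / r₁ * frobNorm (A - B₀) ^ 2 := by
            apply mul_le_mul_of_nonneg_right _ (sq_nonneg _)
            exact div_le_div_of_nonneg_left (by positivity) hr₁pos hnear
        _ ≤ max (3 / 4 : ℝ) ((Real.sqrt N + 1) / r₁) * frobNorm (A - B₀) ^ 2 :=
            mul_le_mul_of_nonneg_right (le_max_right _ _) (sq_nonneg _)


end Morse

end OneLinkLaplace

end Literature.MathematicalPhysics.QuantumFieldTheory
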